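import Mathlib
import Literature.NumberTheory.GaloisRepresentations.NearlyOrdinaryDeformationRing
import HarnessLib

/-!
# NearlyOrdinaryPresentation

Topic `Literature/NumberTheory/GaloisRepresentations`. Named literature fact(s) relocated by the gate from `Summits/Langlands/Langlands/Theorems/SkinnerWilesDefectOneReducibleOrdinaryProModularCMPresentationReduction.lean`
(accept-time relocation of `[cite]`d propositions written inline in a Summits proposal; human ruling 2026-08-15).
Sources: Bockle2007Presentations.

* `Literature.NumberTheory.GaloisRepresentations.NearlyOrdinaryPresentation`
-/

namespace Literature.NumberTheory.GaloisRepresentations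

open scoped NumberField
open IsDedekindDomain
open Literature.NumberTheory.GaloisRepresentations

/-- **Böckle's presentation of the universal nearly ordinary deformation ring** (named fact).  SOURCE.  Let `k`
be a finite field of characteristic `p`, `𝒪` a complete discrete valuation ring of characteristic `0` with
residue field `k`, `F` a number field, `S ⊇ {v ∣ p} ∪ {v ∣ ∞}` finite, `ρ̄ : G_{F,S} → G(k)` residual, and for
`v ∈ S_ord` (all places above `p`, none above `∞`) smooth closed subgroups `P_v ⊂ G` with `ρ̄(G_v) ⊂ P_v(k)`; a
deformation to `R ∈ 𝒞_𝒪` (complete Noetherian local `𝒪`-algebras with residue field `k`) is *`P`-nearly ordinary*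
if at each `v ∈ S_ord` some `g_v ∈ G(R)` reducing to `1` has `g_v ρ g_v⁻¹ (G_v) ⊂ P_v(R)` [Böc07, Ex. 7.1, after
Tilouine–Mauger]; under (Reg) `h⁰(G_v, 𝔤/𝔭_v) = 0` the functor of `P`-nearly ordinary deformations unramified
outside `S` (no condition at `v ∈ S ∖ S_ord`) has a versal hull `R̃ = R̃^{S_ord-n.o.}_{S,𝒪}` [Lemma 7.2],
universal when the centralizer of `Im ρ̄` is the centre [Thm. 2.2(b)], with a presentation
`0 → J̃ → 𝒪⟦T₁,…,T_ℓ̃⟧ → R̃ → 0`, `ℓ̃ = dim_k t_{R̃}`.  **Theorem 7.6** (with Cor. 5.3, Prop. 7.5, and Ex. 6.1(a),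
6.3 for the unrestricted places `v ∤ p` and the complex places): `ℓ̃ − gen(J̃) ≥ h⁰(G_{F,S}, ad ρ̄) −
h⁰(G_{F,S}, (ad ρ̄)^∨) + Σ_{v∣p} [F_v:ℚ_p]·dim 𝔭_v + Σ_{v ∤ p,∞} (ℓ_v − h⁰(G_v, ad) − gen(J̃_v)) −
Σ_{v∣∞} h⁰(G_v, ad ρ̄)`, where `(ad)^∨ = Hom(ad, k)(1) ≅ ad ρ̄ ⊗ ω̄`, `gen` = minimal number of generators, and the
`v ∤ p` terms are `≥ 0` by the local Euler characteristic.  THIS RECORD: `G = GL₂` (`ad = 𝔤𝔩₂`), no fixed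
determinant, `P_v` = the Borel subgroup of the residual special line `(frame v) e₁` (`dim 𝔭_v = 3`; (Reg) ⟺ the
two residual diagonal characters at `v` differ ⟺ `𝒟.IsDistinguishedAt v`; the tree's `IsNearlyOrdinaryAt` is
the `P_v`-nearly ordinary condition), `F` totally complex (each `v ∣ ∞` is complex: `G_v = 1`, `h⁰(G_v, ad) = 4`,
total `2[F:ℚ]`), `h⁰(G_F, ad ρ̄) = 1` (scalar centralizer) and `h⁰(G_F, ad ρ̄ ⊗ ω̄) = 0` ASSUMED (for the
non-split `ρ̄ = (χ̄₁ ∗; 0 χ̄₂)` with scalar centralizer, `p` odd, this holds unless `χ̄₂ = ω̄χ̄₁` or `μ_p ⊂ F`;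
cf. [Böc07, Ex. 6.7]): then
`ℓ̃ − gen(J̃) ≥ 1 + 3[F:ℚ] − 2[F:ℚ] = 1 + [F:ℚ]`, for EVERY universal ring `𝓡` of the interface
`NearlyOrdinaryDeformationRing 𝒟` (all isomorphic, `exists_algEquiv_isStrictEquiv`).  We record the presenting
ring `A ≅ 𝒪⟦T₁,…,T_n⟧` together with the standard facts used downstream: complete Noetherian local, `𝔪_A`
generated by the `A`-regular sequence `(ϖ, T₁, …, T_n)` of length `n + 1 = dim A`.  NOT asserted: the sharper,
level-sensitive count with `h⁰(G_F, ad(1))` replaced by `dim ker(H⁰(G_F, ad(1)) → ⊕_{v ∈ S_f∖S_p} H⁰(G_v, ad(1)))`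
([Böc07, Rem. 5.4]; Kisin, CDM 2005, Prop. 4.1.5 and Rem. 4.1.7(1), a RELATIVE presentation over the local framed
rings). [cite: Bockle2007Presentations, Theorem 7.6 and Corollary 5.3]
[file NumberTheory/GaloisRepresentations/NearlyOrdinaryPresentation] -/
def NearlyOrdinaryPresentation : Prop :=
  ∀ (F : Type) [Field F] [NumberField F], NumberField.IsTotallyComplex F →
    ∀ (p : ℕ) [Fact p.Prime] (𝒪 : Type) [CommRing 𝒪] [IsDomain 𝒪] [IsDiscreteValuationRing 𝒪]
      [CharZero 𝒪] [IsAdicComplete (IsLocalRing.maximalIdeal 𝒪) 𝒪]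
      (k : Type) [Field k] [Finite k] [CharP k p] [Algebra 𝒪 k]
      (𝒟 : NearlyOrdinaryDatum F p 𝒪 k),
      𝒟.HasScalarCentralizer →
      (∀ v : IsDedekindDomain.HeightOneSpectrum (NumberField.RingOfIntegers F),
        (p : NumberField.RingOfIntegers F) ∈ v.asIdeal → 𝒟.IsDistinguishedAt v) →
      (∀ X : Matrix (Fin 2) (Fin 2) k,
        (∀ g : Field.absoluteGaloisGroup F,
          (ZMod.castHom (dvd_refl p) k
              (PadicInt.toZMod ((GaloisRep.cyclotomicCharacter F p g : ℤ_[p]ˣ) : ℤ_[p]))) •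
            ((𝒟.residual g).val * X) = X * (𝒟.residual g).val) → X = 0) →
      ∀ 𝓡 : NearlyOrdinaryDeformationRing.{0} 𝒟,
        ∃ (A : Type) (_ : CommRing A) (_ : IsNoetherianRing A) (_ : IsLocalRing A)
          (_ : IsAdicComplete (IsLocalRing.maximalIdeal A) A) (_ : Algebra 𝒪 A) (n : ℕ)
          (_ : A ≃ₐ[𝒪] MvPowerSeries (Fin n) 𝒪) (rs : List A) (I : Ideal A) (_ : 𝓡.R ≃ₐ[𝒪] A ⧸ I),
          Ideal.ofList rs = IsLocalRing.maximalIdeal A ∧ RingTheory.Sequence.IsRegular A rs ∧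
            rs.length = n + 1 ∧ (rs.length : WithBot ℕ∞) = ringKrullDim A ∧
            I.spanFinrank + 1 + Module.finrank ℚ F ≤ n

/-! ## 2. Bookkeeping: from Böckle's presentation to the shape consumed by (R) and (B) -/

end Literature.NumberTheory.GaloisRepresentations
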